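import Mathlib
import HarnessLib
import Summits.Ventures.LatticeQCDFlow.Scoring.MarkovChainCLT
import Summits.Ventures.LatticeQCDFlow.Scoring.IndepMHRegenerativeSigma

/-!
# Consequences of the Markov-chain CLT: the `τ_int` error bar is asymptotically exact (coverage
# probabilities converge to Gaussian values), and the independence-Metropolis instance

HONEST FRAMING: exact (Metropolis-corrected) sampling algorithms for lattice gauge theory;
figures of merit are autocorrelation/cost numbers at stated couplings and volumes; no
continuum-physics claim.

Venture `LatticeQCDFlow` (cell pub-lqcd), topic `Scoring`; FANOUT row 8 (`s0-cpn-nemc`, GEN-18).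
NEW WORK of the cell, not a published result; no definition is introduced.  Notation of
`Scoring/MarkovChainCLT.lean`: `κ` Markov with invariant `π` and `κ(x, ·) ≥ ε ν` (`0 < ε < 1`),
`|f| ≤ C`, `σ²_f` the Green–Kubo (integrated-autocorrelation) variance, `P_{μ₀}` the path law from
ANY initial law `μ₀`, `f̄_n = (1/n) Σ_{t<n} f(X_t)`.  (i) For every `r > 0`,
`P_{μ₀}(|√n (f̄_n − π f)| ≤ r) → N(0, σ²_f)([−r, r])`: the interval `f̄_n ± r/√n` has asymptotic
coverage equal to the Gaussian value — with `r = z σ_f`, the familiar "`σ_f/√n` times `z`" error bar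
of the `τ_int` method is asymptotically exact from every start (portmanteau theorem,
`MeasureTheory.ProbabilityMeasure.tendsto_measure_of_null_frontier_of_tendsto'`).  (ii) The
independence-Metropolis instance: `q = ρ·π` with `ρ x ≤ e^M ρ y` gives `ε = e^{−M}`, so the time
averages of the IMH chain `indepMH q (1/ρ)` obey the CLT from every start.  Printed counterpart
NAMED ONLY: Meyn–Tweedie 1993 Thm 17.0.1; Geyer 1992 (MCMC error bars) — nothing is cited as a fact.

## Content

* **`markovChain_clt_coverage`** — (i);
* **`indepMH_timeAverage_clt`** — (ii).

NOT CLAIMED: a rate; the studentised (`σ̂` from a window/batch estimator) interval — that needs a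
consistent `σ²_f` estimator along the chain, not proved here; any `ε`, `M` of a concrete sampler.
-/

noncomputable section

namespace Summit.Ventures.LatticeQCDFlow.Scoring

open MeasureTheory ProbabilityTheory Filter Finset Preorder Literature.Probability.MarkovChains
open Summit.Ventures.LatticeQCDFlow.Exactness
open scoped ENNReal Topology

section Coverage

variable {Ω : Type*} [MeasurableSpace Ω]
  {κ : Kernel Ω Ω} [IsMarkovKernel κ] {ν : Measure Ω} [IsProbabilityMeasure ν] {ε : ℝ≥0∞}

/-- **THE `τ_int` ERROR BAR IS ASYMPTOTICALLY EXACT**: `π` invariant, `κ(x, ·) ≥ ε ν` (`0 < ε < 1`),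
`|f| ≤ C` measurable, ANY initial law `μ₀`, `r > 0`:
`P_{μ₀}(|√n ((1/n)Σ_{t<n} f(X_t) − π f)| ≤ r) → (gaussianReal 0 σ²_f) [−r, r]`. -/
theorem markovChain_clt_coverage {π : Measure Ω} [IsProbabilityMeasure π]
    (hπ : Kernel.Invariant κ π) (hmin : ∀ x {B : Set Ω}, MeasurableSet B → ε * ν B ≤ κ x B)
    (hε0 : 0 < ε) (hε : ε < 1)
    {f : Ω → ℝ} (hf : Measurable f) {C : ℝ} (hC : ∀ x, |f x| ≤ C)
    (μ₀ : Measure Ω) [IsProbabilityMeasure μ₀] {r : ℝ} (hr : 0 < r) :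
    Tendsto (fun n : ℕ => (Kernel.trajMeasure (X := fun _ : ℕ => Ω) μ₀
        (fun n : ℕ => κ.comap (fun h : (i : ↥(Finset.Iic n)) → Ω => h ⟨n, Finset.mem_Iic.2 le_rfl⟩)
          (measurable_pi_apply _))).real
      {x | |(Real.sqrt n)⁻¹ * ∑ t ∈ Finset.range n, (f (x t) - ∫ z, f z ∂π)| ≤ r})
      atTop (𝓝 ((gaussianReal 0 (Real.toNNReal ((∫ y, (f y - ∫ z, f z ∂π) ^ 2 ∂π)
      + 2 * ∑' k, ∫ y, (f y - ∫ z, f z ∂π) * (kop κ)^[k + 1] (fun y => f y - ∫ z, f z ∂π) y ∂π))).real (Set.Icc (-r) r))) := by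
  haveI hPI : IsProbabilityMeasure (Kernel.trajMeasure (X := fun _ : ℕ => Ω) μ₀
        (fun n : ℕ => κ.comap (fun h : (i : ↥(Finset.Iic n)) → Ω => h ⟨n, Finset.mem_Iic.2 le_rfl⟩)
          (measurable_pi_apply _))) := inferInstance
  set θ := Real.toNNReal ((∫ y, (f y - ∫ z, f z ∂π) ^ 2 ∂π)
      + 2 * ∑' k, ∫ y, (f y - ∫ z, f z ∂π) * (kop κ)^[k + 1] (fun y => f y - ∫ z, f z ∂π) y ∂π) with hθ
  have hY : HasLaw (fun a : ℝ => a) (gaussianReal 0 θ) (gaussianReal 0 θ) :=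
    ⟨aemeasurable_id', Measure.map_id'⟩
  have hclt := markovChain_clt (κ := κ) (ν := ν) hπ hmin hε0 hε hf hC μ₀ hY
  have hE : ((gaussianReal 0 θ).map (fun a : ℝ => a)) (frontier (Set.Icc (-r) r)) = 0 := by
    rw [Measure.map_id', frontier_Icc (by linarith)]
    by_cases hθ0 : θ = 0
    · rw [hθ0, gaussianReal_zero_var, Measure.dirac_apply' _ (by measurability)]
      simp [Set.indicator, hr.ne', hr.ne]
    · haveI := nullSingletonClass_gaussianReal (μ := 0) hθ0
      exact (Set.toFinite _).measure_zero _
  have key := ProbabilityMeasure.tendsto_measure_of_null_frontier_of_tendsto' hclt.tendsto hE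
  have hset : ∀ n : ℕ, ((Kernel.trajMeasure (X := fun _ : ℕ => Ω) μ₀
        (fun n : ℕ => κ.comap (fun h : (i : ↥(Finset.Iic n)) → Ω => h ⟨n, Finset.mem_Iic.2 le_rfl⟩)
          (measurable_pi_apply _))).map
        (fun x : ℕ → Ω => (Real.sqrt n)⁻¹ * ∑ t ∈ Finset.range n, (f (x t) - ∫ z, f z ∂π))) (Set.Icc (-r) r)
      = (Kernel.trajMeasure (X := fun _ : ℕ => Ω) μ₀
        (fun n : ℕ => κ.comap (fun h : (i : ↥(Finset.Iic n)) → Ω => h ⟨n, Finset.mem_Iic.2 le_rfl⟩)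
          (measurable_pi_apply _)))
        {x | |(Real.sqrt n)⁻¹ * ∑ t ∈ Finset.range n, (f (x t) - ∫ z, f z ∂π)| ≤ r} := by
    intro n
    rw [Measure.map_apply_of_aemeasurable (hclt.forall_aemeasurable n) measurableSet_Icc]
    congr 1
    ext x
    simp only [Set.mem_preimage, Set.mem_Icc, Set.mem_setOf_eq, abs_le]
  have key' := (ENNReal.tendsto_toReal (measure_ne_top _ (Set.Icc (-r) r))).comp key
  simp only [ProbabilityMeasure.coe_mk, Function.comp_def, hset, Measure.map_id'] at key'
  simp only [measureReal_def]
  exact key'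

end Coverage

/-! ### The independence-Metropolis instance -/

section IndepMH

variable {Ω : Type*} [MeasurableSpace Ω]

/-- **CLT FOR TIME AVERAGES OF AN INDEPENDENCE METROPOLIS CHAIN with log-weight oscillation `≤ M`**,
from any initial law `μ₀`: `q = ρ·π`, `ρ > 0` measurable, `ρ x ≤ e^M ρ y`, `|f| ≤ C` measurable; for
any `Y` with law `N(0, σ²_f)` (the Green–Kubo variance of `f` under `indepMH q (1/ρ)`):
`(√n)⁻¹ Σ_{t<n} (f(X_t) − π f) ⇒ Y`. -/
theorem indepMH_timeAverage_clt {π q : Measure Ω} [IsProbabilityMeasure π]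
    [IsProbabilityMeasure q] {ρ : Ω → ℝ} (hρm : Measurable ρ) (hρ0 : ∀ x, 0 < ρ x)
    (hq : q = π.withDensity fun x => ENNReal.ofReal (ρ x)) {M : ℝ} (hM0 : 0 < M)
    (hM : ∀ x y, ρ x ≤ Real.exp M * ρ y)
    {f : Ω → ℝ} (hf : Measurable f) {C : ℝ} (hC : ∀ x, |f x| ≤ C)
    (μ₀ : Measure Ω) [IsProbabilityMeasure μ₀]
    {Ω' : Type*} [MeasurableSpace Ω'] {P' : Measure Ω'} [IsProbabilityMeasure P'] {Y : Ω' → ℝ}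
    (hY : haveI : Fact (Measurable fun x => (ρ x)⁻¹) := ⟨hρm.inv⟩
      HasLaw Y (gaussianReal 0 (Real.toNNReal ((∫ y, (f y - ∫ z, f z ∂π) ^ 2 ∂π)
        + 2 * ∑' k, ∫ y, (f y - ∫ z, f z ∂π)
          * (kop (indepMH q fun x => (ρ x)⁻¹))^[k + 1] (fun y => f y - ∫ z, f z ∂π) y ∂π))) P')
    [hP : haveI : Fact (Measurable fun x => (ρ x)⁻¹) := ⟨hρm.inv⟩
      IsProbabilityMeasure (Kernel.trajMeasure (X := fun _ : ℕ => Ω) μ₀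
        (fun n : ℕ => (indepMH q fun x => (ρ x)⁻¹).comap (fun h : (i : ↥(Finset.Iic n)) → Ω => h ⟨n, Finset.mem_Iic.2 le_rfl⟩)
          (measurable_pi_apply _)))] :
    haveI : Fact (Measurable fun x => (ρ x)⁻¹) := ⟨hρm.inv⟩
    TendstoInDistribution (fun (n : ℕ) (x : ℕ → Ω) => (Real.sqrt n)⁻¹ * ∑ t ∈ Finset.range n, (f (x t) - ∫ z, f z ∂π))
      atTop Y (fun _ => (Kernel.trajMeasure (X := fun _ : ℕ => Ω) μ₀
        (fun n : ℕ => (indepMH q fun x => (ρ x)⁻¹).comap (fun h : (i : ↥(Finset.Iic n)) → Ω => h ⟨n, Finset.mem_Iic.2 le_rfl⟩)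
          (measurable_pi_apply _)))) P' := by
  haveI : Fact (Measurable fun x => (ρ x)⁻¹) := ⟨hρm.inv⟩
  obtain ⟨hinv, -, hdoeb⟩ := indepMH_exact_doeblin_of_density_ratio hρm hρ0 hq hM
  have hε0 : 0 < ENNReal.ofReal (Real.exp (-M)) := ENNReal.ofReal_pos.2 (Real.exp_pos _)
  have hε1 : ENNReal.ofReal (Real.exp (-M)) < 1 := by
    rw [ENNReal.ofReal_lt_one]
    exact Real.exp_lt_one_iff.2 (by linarith)
  exact markovChain_clt (κ := indepMH q fun x => (ρ x)⁻¹) (ν := π) hinv (fun x _ hB => hdoeb x hB) hε0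
    hε1 hf hC μ₀ hY

end IndepMH

end Summit.Ventures.LatticeQCDFlow.Scoring

end
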